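import Literature.NumberTheory.Automorphic.LevelActionInducedCoefficients
import Literature.NumberTheory.Automorphic.LevelActionTwoLevelHecke
import Literature.NumberTheory.Automorphic.LevelActionNormalizingHecke
import Literature.NumberTheory.Automorphic.LevelActionCoefficientEquiv
import Literature.NumberTheory.Automorphic.LevelActionMonoidRestriction
import Mathlib.LinearAlgebra.TensorProduct.Pi
import Mathlib.Algebra.BigOperators.Pi
import HarnessLib

/-!
# Shapiro's isomorphism for sections: the small level as the induced system `𝓕(R[Q])`

Topic `NumberTheory/Automorphic`; namespace `Literature.NumberTheory.Automorphic.LevelAction`;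
definitions with bodies and theorems, no named fact, no instance, no `sorry`.  Universe `0`.

Setting (continuing `LevelActionInducedCoefficients`): levels `U ≤ U' ⊆ Δ`, a homomorphism
`π : U' →* Q` with kernel EXACTLY `U` (`hker`) and a set-theoretic section `s : Q → U'` of `π`
(`hs`; so `Q ≅ U'/U` is finite in the applications: the torus quotient `T(c)/T(c')` of two Hida
levels `U(c', c') ⊴ U(c, c')`).  We identify the four players of the finite-level control of
ordinary cohomology with values of the exact functor `𝓕` (`inducedRep`) and `𝓕` of explicit maps
of `Q`-modules:

* `piRegular R Q` — the left regular representation of `Q` on functions `Q → R`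
  (`(q φ)(q') = φ(q⁻¹ q')`); `rightShift` (right translations, `Q`-equivariant), `unitMap`
  (`η : R → R[Q]`, `r ↦ const r`), `augMap` (`ε : R[Q] → R`, `φ ↦ ∑ φ`), their equivariance;
* `piCoeff`, `toPiFun`/`ofPiFun`, **`piSectionsEquiv`, `piRepIso`** — Shapiro's isomorphism at the
  level of sections, `M(U, τ) ≅ M(U', Fun(Q, V))`, `f ↦ (g ↦ (q ↦ τ(s q) f(g · s q)))`, with
  `U'` acting on `Fun(Q, V)` by `(u ψ)(q) = τ(u) ψ(π(u)⁻¹ q)`; inverse `F ↦ (g ↦ F g 1)`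
  [cite: KhareThorne2017, §6.3 (proof of Prop. 6.6)];
* `tensorEquivPi : R[Q] ⊗ V ≃ Fun(Q, V)` (equivariant: `tensorEquivPi_equivariant`), whence
  **`shapiroIso : M(U, τ) ≅ 𝓕(R[Q])`** and **`trivRepIso : M(U', τ) ≅ 𝓕(R)`** (isomorphisms of
  `Γ`-representations);
* the dictionary (commuting squares in `Rep R Γ`):
  **`resRepHom_comp_shapiroIso_hom`** (`res ↔ 𝓕(η)`), **`shapiroIso_hom_comp_inducedMap_augMap`**
  (`tr = [U' 1 U] ↔ 𝓕(ε)`), **`heckeRepHom_lift_comp_shapiroIso_hom`** (the diamond operator of a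
  lift `s q₀` `↔ 𝓕(right translation by q₀)`), **`heckeRepHom_comp_shapiroIso_hom`** /
  **`heckeRepHom_comp_trivRepIso_hom`** (`[U α U]`, `[U' α U'] ↔` the `U_p`-type operator
  `inducedHecke` of an adapted family of representatives common to both levels).

Also: `heckeOp_apply_eq_sum_of_bijOn` (`[UαU] m = ∑_j act(α_j) m` for representatives indexed
by a finite type), `tau_lift_apply` (independence of the lift), `bijOn_coe_image_lift`
(`{s q}` is a transversal of `U'/U`), `heckeOp₂_one_apply_eq_sum_lift` (`tr f (g) = ∑_q τ(s q) f(g s q)`).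

## References

* C. Khare, J. A. Thorne, *Potential automorphy and the Leopoldt conjecture*, Amer. J. Math.
  139 (2017), §6.3 (Lemma 6.5, Prop. 6.6, Lemma 6.9). [KhareThorne2017]
* H. Hida, Ann. Inst. Fourier 44 (1994), §1–§2. [Hida1994AIF]
* K. S. Brown, *Cohomology of groups*, GTM 87, III.5–III.6 (Shapiro's lemma). [Brown1982CohomologyGroups]
-/

noncomputable section

open CategoryTheory
open scoped TensorProduct

namespace Literature.NumberTheory.Automorphic

namespace LevelAction

/-! ### Hecke operators through representatives indexed by a finite type -/

section Abstract

variable {R : Type} [CommRing R] {𝒢 : Type} [Group 𝒢] {M : Type} [AddCommGroup M] [Module R M]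
  {Δ : Submonoid 𝒢} {θ : Δ →* Module.End R M} {U : Subgroup 𝒢}

/-- **`[U α U] m = ∑_j act(α_j) m`** for a family of representatives `α_j ∈ Δ` indexed by a finite
type `J`, `j ↦ α_j U` a bijection onto `UαU/U`, and `m ∈ M^U`.
[cite: ShimuraIATAF1971, Ch. 3 §3.1] -/
theorem heckeOp_apply_eq_sum_of_bijOn (hU : U.toSubmonoid ≤ Δ) {α : 𝒢} {m : M}
    (hm : m ∈ invariants Δ θ U) {J : Type} [Fintype J] (a : J → 𝒢) (haΔ : ∀ j, a j ∈ Δ)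
    (hbij : Set.BijOn (fun j => ((a j : 𝒢) : 𝒢 ⧸ U)) Set.univ
      (ArithmeticQuotient.doubleCosetQuot U α)) :
    heckeOp Δ θ U α m = ∑ j, act Δ θ (a j) m := by
  classical
  have hfin : (ArithmeticQuotient.doubleCosetQuot U α).Finite := by
    rw [← hbij.image_eq]
    exact Set.finite_univ.image _
  have hset : hfin.toFinset = Finset.univ.image fun j => ((a j : 𝒢) : 𝒢 ⧸ U) :=
    Finset.coe_injective (by
      rw [Set.Finite.coe_toFinset, Finset.coe_image, Finset.coe_univ, hbij.image_eq])
  rw [heckeOp_eq_sum hfin, LinearMap.sum_apply, hset,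
    Finset.sum_image fun j _ j' _ h => hbij.injOn (Set.mem_univ j) (Set.mem_univ j') h]
  exact Finset.sum_congr rfl fun j _ => act_out_apply_eq hU hm (haΔ j) _ rfl

end Abstract

/-! ### The regular representation of a group on functions, and its standard maps -/

section Regular

variable (R : Type) [CommRing R] (Q : Type) [Group Q]

/-- **The left regular representation of `Q` on `Fun(Q, R)`**: `(q φ)(q') = φ(q⁻¹ q')`.
[folklore] -/
def piRegular : Representation R Q (Q → R) where
  toFun q := LinearMap.funLeft R R fun q' => q⁻¹ * q'
  map_one' := LinearMap.ext fun φ => funext fun q' => by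
    simp only [LinearMap.funLeft_apply, inv_one, one_mul, Module.End.one_apply]
  map_mul' a b := LinearMap.ext fun φ => funext fun q' => by
    simp only [LinearMap.funLeft_apply, mul_inv_rev, mul_assoc, Module.End.mul_apply]

/-- Unfolding `piRegular`. [folklore] -/
@[simp]
theorem piRegular_apply (q : Q) (φ : Q → R) (q' : Q) : piRegular R Q q φ q' = φ (q⁻¹ * q') := rfl

/-- **Right translation `(R_{q₀} φ)(q) = φ(q q₀)`** on `Fun(Q, R)`. [folklore] -/
def rightShift (q₀ : Q) : (Q → R) →ₗ[R] (Q → R) :=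
  LinearMap.funLeft R R fun q => q * q₀

/-- Unfolding `rightShift`. [folklore] -/
@[simp]
theorem rightShift_apply (q₀ : Q) (φ : Q → R) (q : Q) : rightShift R Q q₀ φ q = φ (q * q₀) := rfl

/-- Right translations are `Q`-equivariant for the left regular representation. [folklore] -/
theorem rightShift_equivariant (q₀ q : Q) :
    rightShift R Q q₀ ∘ₗ piRegular R Q q = piRegular R Q q ∘ₗ rightShift R Q q₀ :=
  LinearMap.ext fun φ => funext fun q' => by
    simp only [LinearMap.comp_apply, rightShift_apply, piRegular_apply, mul_assoc]

/-- **The unit `η : R → Fun(Q, R)`, `r ↦ (q ↦ r)`** (the norm element `∑_q [q]` times `r`).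
[folklore] -/
def unitMap : R →ₗ[R] (Q → R) :=
  LinearMap.pi fun _ => LinearMap.id

omit [Group Q] in
/-- Unfolding `unitMap`. [folklore] -/
@[simp]
theorem unitMap_apply (r : R) (q : Q) : unitMap R Q r q = r := rfl

/-- `η` is equivariant (trivial action on `R`, regular on `Fun(Q, R)`). [folklore] -/
theorem unitMap_equivariant (q : Q) :
    unitMap R Q ∘ₗ Representation.trivial R Q R q = piRegular R Q q ∘ₗ unitMap R Q :=
  LinearMap.ext fun r => funext fun q' => by
    simp only [LinearMap.comp_apply, Representation.trivial_apply, piRegular_apply, unitMap_apply]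

variable [Fintype Q]

/-- **The augmentation `ε : Fun(Q, R) → R`, `φ ↦ ∑_q φ(q)`.** [folklore] -/
def augMap : (Q → R) →ₗ[R] R :=
  ∑ q : Q, LinearMap.proj q

omit [Group Q] in
/-- Unfolding `augMap`. [folklore] -/
@[simp]
theorem augMap_apply (φ : Q → R) : augMap R Q φ = ∑ q, φ q := by
  simp only [augMap, LinearMap.sum_apply, LinearMap.proj_apply]

/-- `ε` is equivariant (regular action on `Fun(Q, R)`, trivial on `R`). [folklore] -/
theorem augMap_equivariant (q : Q) :
    augMap R Q ∘ₗ piRegular R Q q = Representation.trivial R Q R q ∘ₗ augMap R Q :=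
  LinearMap.ext fun φ => by
    simp only [LinearMap.comp_apply, Representation.trivial_apply, augMap_apply, piRegular_apply]
    exact Fintype.sum_equiv (Equiv.mulLeft q⁻¹) _ _ fun _ => rfl

omit [Group Q] in
/-- `ε` of an indicator function is `1`. [folklore] -/
theorem augMap_single [DecidableEq Q] (q : Q) : augMap R Q (Pi.single q 1) = 1 := by
  rw [augMap_apply]
  exact Fintype.sum_pi_single' q 1

end Regular

/-! ### `Fun(Q, V)`-valued sections at the big level (Shapiro for sections) -/

section Pi

variable {R : Type} [CommRing R] {Γ 𝒢 : Type} [Group Γ] [Group 𝒢] (ι : Γ →* 𝒢)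
  {Δ : Submonoid 𝒢} {V : Type} [AddCommGroup V] [Module R V] (τ : Δ →* Module.End R V)
  {U U' : Subgroup 𝒢} (hU : U.toSubmonoid ≤ Δ) (hU' : U'.toSubmonoid ≤ Δ) (hle : U ≤ U')
  {Q : Type} [Group Q] (π : U' →* Q) (hker : ∀ u : U', π u = 1 ↔ (u : 𝒢) ∈ U)
  (s : Q → U') (hs : ∀ q, π (s q) = q)

include hU hker hs in
/-- **Independence of the lift**: for `f ∈ M(U, τ)` and `u' ∈ U'` with `π u' = q`,
`τ(u') f(x u') = τ(s q) f(x · s q)` (`u' = s q · u₀`, `u₀ ∈ U = ker π`). [folklore] -/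
theorem tau_lift_apply {f : 𝒢 → V} (hf : f ∈ sections Δ τ U) (x : 𝒢) {q : Q} (u' : U')
    (hq : π u' = q) :
    τ ⟨u', hU' u'.2⟩ (f (x * u')) = τ ⟨s q, hU' (s q).2⟩ (f (x * s q)) := by
  have hu₀ : π ((s q)⁻¹ * u') = 1 := by rw [map_mul, map_inv, hs, hq, inv_mul_cancel]
  have hu₀U : ((s q : 𝒢)⁻¹ * u' : 𝒢) ∈ U := (hker _).1 hu₀
  have hsec := (mem_sections_iff hU).1 hf (x * s q) _ hu₀U
  have hmul : x * (s q : 𝒢) * ((s q : 𝒢)⁻¹ * u') = x * u' := by rw [mul_assoc, mul_inv_cancel_left]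
  rw [hmul] at hsec
  have hΔ : (⟨(s q : 𝒢), hU' (s q).2⟩ * ⟨(s q : 𝒢)⁻¹ * u', hU hu₀U⟩ : Δ) = ⟨u', hU' u'.2⟩ :=
    Subtype.ext (mul_inv_cancel_left (s q : 𝒢) (u' : 𝒢))
  rw [← hsec, ← Module.End.mul_apply, ← map_mul, hΔ]

/-- The `U'`-action on `Fun(Q, V)`: `(u ψ)(q) = τ(u) ψ(π(u)⁻¹ q)`, as a linear map. [folklore] -/
def piCoeffMap (u : U'.toSubmonoid) : (Q → V) →ₗ[R] (Q → V) where
  toFun ψ q := τ ⟨u, hU' u.2⟩ (ψ ((π (toSubgroupHom U' u))⁻¹ * q))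
  map_add' ψ ψ' := funext fun q => by simp only [Pi.add_apply, map_add]
  map_smul' c ψ := funext fun q => by simp only [Pi.smul_apply, map_smul, RingHom.id_apply]

/-- Unfolding `piCoeffMap`. [folklore] -/
@[simp]
theorem piCoeffMap_apply (u : U'.toSubmonoid) (ψ : Q → V) (q : Q) :
    piCoeffMap τ hU' π u ψ q = τ ⟨u, hU' u.2⟩ (ψ ((π (toSubgroupHom U' u))⁻¹ * q)) := rfl

/-- **The coefficient system `Fun(Q, V)` of level `U'`**: `(u ψ)(q) = τ(u) ψ(π(u)⁻¹ q)` (the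
induced module of `V|_U` from `U` to `U'`, written as functions on `Q = U'/U`).
[cite: KhareThorne2017, §6.3] [cite: Brown1982CohomologyGroups, III.5] -/
def piCoeff : U'.toSubmonoid →* Module.End R (Q → V) where
  toFun := piCoeffMap τ hU' π
  map_one' := LinearMap.ext fun ψ => funext fun q => by
    rw [piCoeffMap_apply, map_one, map_one, inv_one, one_mul, Module.End.one_apply]
    have h1 : (⟨((1 : U'.toSubmonoid) : 𝒢), hU' (1 : U'.toSubmonoid).2⟩ : Δ) = 1 := rfl
    rw [h1, map_one, Module.End.one_apply]
  map_mul' a b := LinearMap.ext fun ψ => funext fun q => by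
    rw [Module.End.mul_apply, piCoeffMap_apply, piCoeffMap_apply, piCoeffMap_apply, map_mul, map_mul,
      mul_inv_rev, mul_assoc]
    have hab : (⟨((a * b : U'.toSubmonoid) : 𝒢), hU' (a * b).2⟩ : Δ) = ⟨a, hU' a.2⟩ * ⟨b, hU' b.2⟩ := rfl
    rw [hab, map_mul, Module.End.mul_apply]

/-- Unfolding `piCoeff`. [folklore] -/
@[simp]
theorem piCoeff_apply (u : U'.toSubmonoid) (ψ : Q → V) (q : Q) :
    piCoeff τ hU' π u ψ q = τ ⟨u, hU' u.2⟩ (ψ ((π (toSubgroupHom U' u))⁻¹ * q)) := rfl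

/-- **Shapiro's map on functions**: `f ↦ (g ↦ (q ↦ τ(s q) f(g · s q)))`. [cite: KhareThorne2017, §6.3] -/
def toPiFun : (𝒢 → V) →ₗ[R] (𝒢 → Q → V) where
  toFun f g q := τ ⟨s q, hU' (s q).2⟩ (f (g * s q))
  map_add' f f' := funext fun g => funext fun q => by simp only [Pi.add_apply, map_add]
  map_smul' c f := funext fun g => funext fun q => by
    simp only [Pi.smul_apply, map_smul, RingHom.id_apply]

omit [Group Q] in
/-- Unfolding `toPiFun`. [folklore] -/
@[simp]
theorem toPiFun_apply (f : 𝒢 → V) (g : 𝒢) (q : Q) :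
    toPiFun τ hU' s f g q = τ ⟨s q, hU' (s q).2⟩ (f (g * s q)) := rfl

include hU hker hs in
/-- **Shapiro's map sends `M(U, τ)` into `M(U', Fun(Q, V))`.** [cite: KhareThorne2017, §6.3] -/
theorem toPiFun_mem_sections {f : 𝒢 → V} (hf : f ∈ sections Δ τ U) :
    toPiFun τ hU' s f ∈ sections U'.toSubmonoid (piCoeff τ hU' π) U' := by
  rw [mem_sections_iff (level_le_self (U' := U'))]
  intro g u hu
  funext q
  have hw : π (⟨u, hu⟩ * s ((π ⟨u, hu⟩)⁻¹ * q)) = q := by rw [map_mul, hs, mul_inv_cancel_left]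
  have key := tau_lift_apply τ hU hU' π hker s hs hf g _ hw
  change τ ⟨u, hU' hu⟩ (τ ⟨(s ((π ⟨u, hu⟩)⁻¹ * q) : 𝒢), hU' (s _).2⟩
      (f (g * u * s ((π ⟨u, hu⟩)⁻¹ * q)))) = τ ⟨s q, hU' (s q).2⟩ (f (g * s q))
  rw [← key, ← Module.End.mul_apply, ← map_mul, mul_assoc]
  rfl

omit [Group Q] in
/-- Shapiro's map commutes with left translations. [folklore] -/
theorem toPiFun_leftTranslation (γ : Γ) (f : 𝒢 → V) :
    toPiFun τ hU' s (leftTranslation R ι V γ f) = leftTranslation R ι (Q → V) γ (toPiFun τ hU' s f) := by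
  funext g q
  simp only [toPiFun_apply, leftTranslation_apply, mul_assoc]

variable (R) in
/-- The inverse map on functions: `F ↦ (g ↦ F g 1)`. [folklore] -/
def ofPiFun : (𝒢 → Q → V) →ₗ[R] (𝒢 → V) where
  toFun F g := F g 1
  map_add' _ _ := rfl
  map_smul' _ _ := rfl

omit [Group 𝒢] in
/-- Unfolding `ofPiFun`. [folklore] -/
@[simp]
theorem ofPiFun_apply (F : 𝒢 → Q → V) (g : 𝒢) : ofPiFun R F g = F g 1 := rfl

include hU hle hker in
/-- The inverse map sends `M(U', Fun(Q, V))` into `M(U, τ)`. [folklore] -/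
theorem ofPiFun_mem_sections {F : 𝒢 → Q → V}
    (hF : F ∈ sections U'.toSubmonoid (piCoeff τ hU' π) U') : ofPiFun R F ∈ sections Δ τ U := by
  rw [mem_sections_iff hU]
  intro g u hu
  have h := congr_fun ((mem_sections_iff (level_le_self (U' := U'))).1 hF g u (hle hu)) 1
  have hπ : π ⟨u, hle hu⟩ = 1 := (hker _).2 hu
  change τ ⟨u, _⟩ (F (g * u) ((π ⟨u, hle hu⟩)⁻¹ * 1)) = F g 1 at h
  rw [hπ, inv_one, one_mul] at h
  exact h

include hU hker hs in
/-- `ofPiFun ∘ toPiFun = id` on `M(U, τ)` (`s 1 ∈ U`). [folklore] -/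
theorem ofPiFun_toPiFun {f : 𝒢 → V} (hf : f ∈ sections Δ τ U) :
    ofPiFun R (toPiFun τ hU' s f) = f := by
  funext g
  have h1 : ((s 1 : U') : 𝒢) ∈ U := (hker _).1 (hs 1)
  exact (mem_sections_iff hU).1 hf g _ h1

include hs in
/-- `toPiFun ∘ ofPiFun = id` on `M(U', Fun(Q, V))`. [folklore] -/
theorem toPiFun_ofPiFun {F : 𝒢 → Q → V}
    (hF : F ∈ sections U'.toSubmonoid (piCoeff τ hU' π) U') : toPiFun τ hU' s (ofPiFun R F) = F := by
  funext g q
  have h := congr_fun ((mem_sections_iff (level_le_self (U' := U'))).1 hF g (s q) (s q).2) q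
  change τ ⟨s q, _⟩ (F (g * s q) ((π ⟨(s q : 𝒢), (s q).2⟩)⁻¹ * q)) = F g q at h
  have hπ : π ⟨(s q : 𝒢), (s q).2⟩ = q := by rw [Subtype.coe_eta]; exact hs q
  rw [hπ, inv_mul_cancel] at h
  exact h

/-- Shapiro's map `M(U, τ) → M(U', Fun(Q, V))`. [cite: KhareThorne2017, §6.3] -/
def toPi : sections Δ τ U →ₗ[R] sections U'.toSubmonoid (piCoeff τ hU' π) U' :=
  (toPiFun τ hU' s).restrict fun _ hf => toPiFun_mem_sections τ hU hU' π hker s hs hf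

/-- Its inverse `M(U', Fun(Q, V)) → M(U, τ)`. [folklore] -/
def ofPi : sections U'.toSubmonoid (piCoeff τ hU' π) U' →ₗ[R] sections Δ τ U :=
  (ofPiFun R).restrict fun _ hF => ofPiFun_mem_sections τ hU hU' hle π hker hF

/-- **Shapiro's isomorphism for sections `M(U, τ) ≃ M(U', Fun(Q, V))`.**
[cite: KhareThorne2017, §6.3] [cite: Brown1982CohomologyGroups, III.5–III.6] -/
def piSectionsEquiv : sections Δ τ U ≃ₗ[R] sections U'.toSubmonoid (piCoeff τ hU' π) U' :=
  LinearEquiv.ofLinear (toPi τ hU hU' π hker s hs) (ofPi τ hU hU' hle π hker)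
    (LinearMap.ext fun F => Subtype.ext (toPiFun_ofPiFun τ hU' π s hs F.2))
    (LinearMap.ext fun f => Subtype.ext (ofPiFun_toPiFun τ hU hU' π hker s hs f.2))

/-- Unfolding `piSectionsEquiv`. [folklore] -/
@[simp]
theorem coe_piSectionsEquiv_apply (f : sections Δ τ U) :
    ((piSectionsEquiv τ hU hU' hle π hker s hs f : sections U'.toSubmonoid (piCoeff τ hU' π) U') :
      𝒢 → Q → V) = toPiFun τ hU' s f := rfl

/-- Unfolding the inverse of `piSectionsEquiv`. [folklore] -/
@[simp]
theorem coe_piSectionsEquiv_symm_apply (F : sections U'.toSubmonoid (piCoeff τ hU' π) U') :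
    (((piSectionsEquiv τ hU hU' hle π hker s hs).symm F : sections Δ τ U) : 𝒢 → V) =
      ofPiFun R (F : 𝒢 → Q → V) :=
  rfl

/-- **Shapiro's isomorphism `M(U, τ) ≅ M(U', Fun(Q, V))` of `Γ`-representations.**
[cite: KhareThorne2017, §6.3] [cite: Brown1982CohomologyGroups, III.6] -/
def piRepIso : Rep.of (rep ι Δ τ U) ≅ Rep.of (rep ι U'.toSubmonoid (piCoeff τ hU' π) U') :=
  Rep.mkIso (Representation.Equiv.mk (piSectionsEquiv τ hU hU' hle π hker s hs) fun γ =>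
    LinearMap.ext fun f => Subtype.ext (toPiFun_leftTranslation ι τ hU' s γ (f : 𝒢 → V)))

/-- Unfolding `piRepIso` pointwise. [folklore] -/
@[simp]
theorem piRepIso_hom_apply_coe (f : sections Δ τ U) :
    (((piRepIso ι τ hU hU' hle π hker s hs).hom.hom f :
      sections U'.toSubmonoid (piCoeff τ hU' π) U') : 𝒢 → Q → V) = toPiFun τ hU' s f := rfl

include hU hker hs in
/-- **Diamond operators under Shapiro**: for `f ∈ M(U, τ)` and the lift `z = s q₀` (in `Δ`),
`toPiFun (act z f) g q = toPiFun f g (q q₀)` — the operator `f ↦ τ(z) f(· z)` becomes right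
translation by `q₀` on `Fun(Q, V)`. [cite: Hida1994AIF, §2] -/
theorem toPiFun_act_lift {f : 𝒢 → V} (hf : f ∈ sections Δ τ U) (q₀ : Q) (g : 𝒢) (q : Q) :
    toPiFun τ hU' s (act Δ (fnAction Δ τ) (s q₀ : 𝒢) f) g q = toPiFun τ hU' s f g (q * q₀) := by
  have hw : π (s q * s q₀) = q * q₀ := by rw [map_mul, hs, hs]
  rw [act_of_mem (hU' (s q₀).2), toPiFun_apply, fnAction_apply, toPiFun_apply,
    ← tau_lift_apply τ hU hU' π hker s hs hf g (s q * s q₀) hw, ← Module.End.mul_apply, ← map_mul,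
    mul_assoc]
  rfl

include hU hker hs in
/-- **`U_p`-type operators under Shapiro**: for an adapted family `α_j` whose cosets `α_j U`
enumerate `UαU/U`, `toPiFun ([UαU] f) g q = ∑_j τ(α_j) (toPiFun f (g α_j) q)`.
[cite: KhareThorne2017, §6.3, Lemma 6.5] -/
theorem toPiFun_heckeOp {f : 𝒢 → V} (hf : f ∈ sections Δ τ U) {α : 𝒢} {J : Type} [Fintype J]
    {a : J → 𝒢} (ha : IsAdaptedFamily Δ U' π a)
    (hbij : Set.BijOn (fun j => ((a j : 𝒢) : 𝒢 ⧸ U)) Set.univ (ArithmeticQuotient.doubleCosetQuot U α))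
    (g : 𝒢) (q : Q) :
    toPiFun τ hU' s (heckeOp Δ (fnAction Δ τ) U α f) g q =
      ∑ j, τ ⟨a j, ha.mem j⟩ (toPiFun τ hU' s f (g * a j) q) := by
  rw [toPiFun_apply, heckeOp_apply_eq_sum_of_bijOn hU hf a ha.mem hbij, Finset.sum_apply, map_sum]
  obtain ⟨σ, hσ⟩ := ha.perm (s q)
  have hterm : ∀ j, τ ⟨s q, hU' (s q).2⟩ (act Δ (fnAction Δ τ) (a j) f (g * s q)) =
      τ ⟨a (σ j), ha.mem (σ j)⟩ (toPiFun τ hU' s f (g * a (σ j)) q) := fun j => by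
    obtain ⟨u', h, hπ⟩ := hσ j
    rw [act_of_mem (ha.mem j), fnAction_apply, toPiFun_apply, ← Module.End.mul_apply, ← map_mul,
      ← tau_lift_apply τ hU hU' π hker s hs hf (g * a (σ j)) u' (hπ.trans (hs q)),
      ← Module.End.mul_apply, ← map_mul]
    have hΔ : (⟨(s q : 𝒢), hU' (s q).2⟩ * ⟨a j, ha.mem j⟩ : Δ) =
        ⟨a (σ j), ha.mem (σ j)⟩ * ⟨u', hU' u'.2⟩ := Subtype.ext h
    rw [hΔ, mul_assoc, h, ← mul_assoc]
  rw [Finset.sum_congr rfl fun j _ => hterm j]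
  exact Equiv.sum_comp σ (fun j => τ ⟨a j, ha.mem j⟩ (toPiFun τ hU' s f (g * a j) q))

/-! #### The transversal `{s q}` of `U'/U` and the transfer -/

include hker hs in
/-- **`{s q : q ∈ Q}` is a transversal of `U'/U`.** [folklore] -/
theorem bijOn_coe_image_lift [Fintype Q] [DecidableEq 𝒢] :
    Set.BijOn (fun x : 𝒢 => (x : 𝒢 ⧸ U)) ↑(Finset.univ.image fun q => ((s q : U') : 𝒢))
      (ArithmeticQuotient.doubleCosetQuot₂ U' U 1) := by
  rw [ArithmeticQuotient.doubleCosetQuot₂_one_eq_range, Finset.coe_image, Finset.coe_univ,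
    Set.image_univ]
  refine ⟨?_, ?_, ?_⟩
  · rintro _ ⟨q, rfl⟩
    exact ⟨s q, rfl⟩
  · rintro _ ⟨q, rfl⟩ _ ⟨q', rfl⟩ h
    have hqq : ((s q : U') : 𝒢)⁻¹ * (s q' : U') ∈ U := QuotientGroup.eq.1 h
    have hπ : π ((s q)⁻¹ * s q') = 1 := (hker _).2 hqq
    rw [map_mul, map_inv, hs, hs, inv_mul_eq_one] at hπ
    rw [hπ]
  · rintro _ ⟨l, rfl⟩
    refine ⟨(s (π l) : 𝒢), ⟨π l, rfl⟩, ?_⟩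
    refine QuotientGroup.eq.2 ((hker ((s (π l))⁻¹ * l)).1 ?_)
    rw [map_mul, map_inv, hs, inv_mul_cancel]

include hs in
/-- `q ↦ (s q : 𝒢)` is injective. [folklore] -/
theorem coe_lift_injective : Function.Injective fun q => ((s q : U') : 𝒢) := fun q q' h => by
  have h' : s q = s q' := Subtype.ext h
  rw [← hs q, ← hs q', h']

include hU hle hker hs in
/-- **The transfer through the lifts**: `[U' 1 U] f (g) = ∑_q τ(s q) f(g · s q)` for `f ∈ M(U, τ)`,
i.e. `tr f (g) = ∑_q toPiFun f g q`. [cite: Hida1994AIF, §2] -/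
theorem heckeOp₂_one_apply_eq_sum_lift [Fintype Q] {f : 𝒢 → V} (hf : f ∈ sections Δ τ U) (g : 𝒢) :
    heckeOp₂ Δ (fnAction Δ τ) U' U 1 f g = ∑ q, toPiFun τ hU' s f g q := by
  classical
  rw [heckeOp₂_one_apply_eq_sum hU hU' hle (bijOn_coe_image_lift π hker s hs) hf, Finset.sum_apply,
    Finset.sum_image fun q _ q' _ h => coe_lift_injective π s hs h]
  refine Finset.sum_congr rfl fun q _ => ?_
  rw [act_of_mem (hU' (s q).2), fnAction_apply, toPiFun_apply]

end Pi

/-! ### `R[Q] ⊗ V ≃ Fun(Q, V)` and the identification with `𝓕(R[Q])` -/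

section Tensor

variable (R : Type) [CommRing R] (V : Type) [AddCommGroup V] [Module R V] (Q : Type) [Fintype Q]
  [DecidableEq Q]

/-- **`Fun(Q, R) ⊗_R V ≃ Fun(Q, V)`**, `φ ⊗ v ↦ (q ↦ φ(q) v)`. [folklore] -/
def tensorEquivPi : (Q → R) ⊗[R] V ≃ₗ[R] (Q → V) :=
  TensorProduct.comm R (Q → R) V ≪≫ₗ TensorProduct.piScalarRight R R V Q

variable {R V Q}

/-- `tensorEquivPi` on pure tensors. [folklore] -/
@[simp]
theorem tensorEquivPi_tmul (φ : Q → R) (v : V) : tensorEquivPi R V Q (φ ⊗ₜ v) = fun q => φ q • v := by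
  simp [tensorEquivPi]

/-- The inverse on an indicator function. [folklore] -/
theorem tensorEquivPi_symm_single (q : Q) (v : V) :
    (tensorEquivPi R V Q).symm (Pi.single q v) = Pi.single q (1 : R) ⊗ₜ v := by
  simp [tensorEquivPi]

/-- **The inverse: `ψ ↦ ∑_q [q] ⊗ ψ(q)`.** [folklore] -/
theorem tensorEquivPi_symm_apply (ψ : Q → V) :
    (tensorEquivPi R V Q).symm ψ = ∑ q, Pi.single q (1 : R) ⊗ₜ ψ q := by
  conv_lhs => rw [← Finset.univ_sum_single ψ]
  rw [map_sum]
  exact Finset.sum_congr rfl fun q _ => tensorEquivPi_symm_single q (ψ q)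

/-- Naturality of `tensorEquivPi` in maps `Fun(Q, R) → Fun(Q, R)` of the form `φ ↦ φ ∘ c`.
[folklore] -/
theorem tensorEquivPi_comp_rTensor_funLeft (c : Q → Q) :
    (tensorEquivPi R V Q : _ →ₗ[R] Q → V) ∘ₗ (LinearMap.funLeft R R c).rTensor V =
      LinearMap.funLeft R V c ∘ₗ (tensorEquivPi R V Q : _ →ₗ[R] Q → V) :=
  TensorProduct.ext' fun φ v => funext fun q => by
    simp only [LinearMap.comp_apply, LinearMap.rTensor_tmul, LinearEquiv.coe_coe, tensorEquivPi_tmul,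
      LinearMap.funLeft_apply]

/-- Naturality of `tensorEquivPi` in `V`: `e ∘ (1 ⊗ T) = (T ∘ -) ∘ e`. [folklore] -/
theorem tensorEquivPi_comp_lTensor (T : V →ₗ[R] V) :
    (tensorEquivPi R V Q : _ →ₗ[R] Q → V) ∘ₗ T.lTensor (Q → R) =
      T.compLeft Q ∘ₗ (tensorEquivPi R V Q : _ →ₗ[R] Q → V) :=
  TensorProduct.ext' fun φ v => funext fun q => by
    simp only [LinearMap.comp_apply, LinearMap.lTensor_tmul, LinearEquiv.coe_coe, tensorEquivPi_tmul,
      LinearMap.compLeft_apply, Function.comp_apply, map_smul]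

/-- `e ∘ (η ⊗ 1)`: `η(r) ⊗ v ↦ (q ↦ r v)`. [folklore] -/
theorem tensorEquivPi_rTensor_unitMap_tmul [Group Q] (r : R) (v : V) :
    tensorEquivPi R V Q ((unitMap R Q).rTensor V (r ⊗ₜ v)) = fun _ => r • v := by
  rw [LinearMap.rTensor_tmul, tensorEquivPi_tmul]
  rfl

/-- `(ε ⊗ 1) ∘ e⁻¹`: `ψ ↦ 1 ⊗ ∑_q ψ(q)`. [folklore] -/
theorem rTensor_augMap_tensorEquivPi_symm [Group Q] (ψ : Q → V) :
    (augMap R Q).rTensor V ((tensorEquivPi R V Q).symm ψ) = (1 : R) ⊗ₜ ∑ q, ψ q := by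
  rw [tensorEquivPi_symm_apply, map_sum, TensorProduct.tmul_sum]
  refine Finset.sum_congr rfl fun q _ => ?_
  rw [LinearMap.rTensor_tmul, augMap_single]

end Tensor

section Shapiro

variable {R : Type} [CommRing R] {Γ 𝒢 : Type} [Group Γ] [Group 𝒢] (ι : Γ →* 𝒢)
  {Δ : Submonoid 𝒢} {V : Type} [AddCommGroup V] [Module R V] (τ : Δ →* Module.End R V)
  {U U' : Subgroup 𝒢} (hU : U.toSubmonoid ≤ Δ) (hU' : U'.toSubmonoid ≤ Δ) (hle : U ≤ U')
  {Q : Type} [Group Q] (π : U' →* Q)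
  (hker : ∀ u : U', π u = 1 ↔ (u : 𝒢) ∈ U) (s : Q → U') (hs : ∀ q, π (s q) = q)

/-- `TensorProduct.lid` is `U'`-equivariant from `𝓕`'s coefficients `R ⊗ V` (trivial `Q`-action
on `R`) to `V`. [folklore] -/
theorem lid_equivariant (u : U'.toSubmonoid) :
    (TensorProduct.lid R V : R ⊗[R] V →ₗ[R] V) ∘ₗ inducedCoeff τ hU' π (Representation.trivial R Q R) u =
      (τ.comp (Submonoid.inclusion hU')) u ∘ₗ (TensorProduct.lid R V : R ⊗[R] V →ₗ[R] V) := by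
  refine TensorProduct.ext' fun r v => ?_
  simp only [LinearMap.comp_apply, LinearEquiv.coe_coe, inducedCoeff_apply_tmul,
    Representation.trivial_apply, TensorProduct.lid_tmul, map_smul, MonoidHom.comp_apply]

/-- **`M(U', τ) ≅ 𝓕(R)`** (`R` with the trivial `Q`-action): restrict the coefficient monoid
from `Δ` to `U'` and insert `V ≅ R ⊗ V`. [cite: KhareThorne2017, §6.3] -/
def trivRepIso : Rep.of (rep ι Δ τ U') ≅ inducedRep ι τ hU' π (Representation.trivial R Q R) :=
  (repIsoOfRestrict ι hU' (τ := τ) (τ' := τ.comp (Submonoid.inclusion hU')) (fun _ _ => rfl)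
      level_le_self).symm ≪≫
    (repIsoOfCoeffEquiv ι U'.toSubmonoid (inducedCoeff τ hU' π (Representation.trivial R Q R))
      (τ.comp (Submonoid.inclusion hU')) U' (TensorProduct.lid R V) (lid_equivariant τ hU' π)).symm

/-- Unfolding `trivRepIso` pointwise: `f ↦ (g ↦ 1 ⊗ f g)`. [folklore] -/
theorem trivRepIso_hom_apply_coe (f : sections Δ τ U') (g : 𝒢) :
    (((trivRepIso ι τ hU' π).hom.hom f :
      sections U'.toSubmonoid (inducedCoeff τ hU' π (Representation.trivial R Q R)) U') :
        𝒢 → R ⊗[R] V) g = (1 : R) ⊗ₜ (f : 𝒢 → V) g :=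
  rfl

include hle hker in
/-- A lift `s q₀` normalises `U = ker π`. [folklore] -/
theorem lift_normalizing (q₀ : Q) : ∀ u ∈ U, ((s q₀ : U') : 𝒢)⁻¹ * u * (s q₀ : U') ∈ U := by
  intro u hu
  have hu' : π ⟨u, hle hu⟩ = 1 := (hker _).2 hu
  have h : π ((s q₀)⁻¹ * ⟨u, hle hu⟩ * s q₀) = 1 := by
    rw [map_mul, map_mul, map_inv, hu', mul_one, inv_mul_cancel]
  exact (hker _).1 h

variable [Fintype Q] [DecidableEq Q]


/-- **`tensorEquivPi` is `U'`-equivariant** from the induced coefficient system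
`R[Q] ⊗ V` (`inducedCoeff` of the regular representation) to `Fun(Q, V)` (`piCoeff`).
[cite: KhareThorne2017, §6.3] -/
theorem tensorEquivPi_equivariant (u : U'.toSubmonoid) :
    (tensorEquivPi R V Q : _ →ₗ[R] Q → V) ∘ₗ inducedCoeff τ hU' π (piRegular R Q) u =
      piCoeff τ hU' π u ∘ₗ (tensorEquivPi R V Q : _ →ₗ[R] Q → V) := by
  refine TensorProduct.ext' fun φ v => funext fun q => ?_
  simp only [LinearMap.comp_apply, LinearEquiv.coe_coe, inducedCoeff_apply_tmul, tensorEquivPi_tmul,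
    piCoeff_apply, piRegular_apply, map_smul]
  rfl

/-- **`𝓕(R[Q]) ≅ M(U', Fun(Q, V))`** along `tensorEquivPi`. [cite: KhareThorne2017, §6.3] -/
def regRepIso : inducedRep ι τ hU' π (piRegular R Q) ≅ Rep.of (rep ι U'.toSubmonoid (piCoeff τ hU' π) U') :=
  repIsoOfCoeffEquiv ι U'.toSubmonoid (inducedCoeff τ hU' π (piRegular R Q)) (piCoeff τ hU' π) U'
    (tensorEquivPi R V Q) (tensorEquivPi_equivariant τ hU' π)

/-- **Shapiro's isomorphism `M(U, τ) ≅ 𝓕(R[Q])`** of `Γ`-representations: the sections at the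
small level `U = ker π` are the sections at level `U'` of the induced coefficient system of the
regular representation of `Q = U'/U`. [cite: KhareThorne2017, §6.3 (proof of Prop. 6.6)]
[cite: Brown1982CohomologyGroups, III.6] -/
def shapiroIso : Rep.of (rep ι Δ τ U) ≅ inducedRep ι τ hU' π (piRegular R Q) :=
  piRepIso ι τ hU hU' hle π hker s hs ≪≫ (regRepIso ι τ hU' π).symm

/-- Unfolding `shapiroIso` pointwise: `f ↦ (g ↦ e⁻¹ (q ↦ τ(s q) f(g s q)))`. [folklore] -/
theorem shapiroIso_hom_apply_coe (f : sections Δ τ U) (g : 𝒢) :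
    (((shapiroIso ι τ hU hU' hle π hker s hs).hom.hom f :
      sections U'.toSubmonoid (inducedCoeff τ hU' π (piRegular R Q)) U') : 𝒢 → (Q → R) ⊗[R] V) g =
      (tensorEquivPi R V Q).symm (toPiFun τ hU' s f g) :=
  rfl

/-! ### The dictionary -/

/-- **`res ↔ 𝓕(η)`**: restriction `M(U', τ) → M(U, τ)` followed by Shapiro is `𝓕` of the unit
`η : R → R[Q]`. [cite: KhareThorne2017, §6.3 (proof of Prop. 6.6)] -/
theorem resRepHom_comp_shapiroIso_hom :
    resRepHom ι Δ τ hle ≫ (shapiroIso ι τ hU hU' hle π hker s hs).hom =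
      (trivRepIso ι τ hU' π).hom ≫ inducedMap ι τ hU' π (Representation.trivial R Q R) (piRegular R Q)
        (unitMap R Q) (unitMap_equivariant R Q) := by
  refine Rep.hom_ext (Representation.IntertwiningMap.ext (LinearMap.ext fun f => Subtype.ext
    (funext fun g => ?_)))
  change (tensorEquivPi R V Q).symm (toPiFun τ hU' s ((resRepHom ι Δ τ hle).hom f) g) =
    (unitMap R Q).rTensor V ((1 : R) ⊗ₜ (f : 𝒢 → V) g)
  rw [LinearEquiv.symm_apply_eq, tensorEquivPi_rTensor_unitMap_tmul]
  funext q
  rw [toPiFun_apply, resRepHom_hom_apply_coe, one_smul]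
  exact (mem_sections_iff hU').1 f.2 g (s q) (s q).2

/-- **`tr ↔ 𝓕(ε)`**: Shapiro followed by `𝓕` of the augmentation `ε : R[Q] → R` is the transfer
`[U' 1 U] : M(U, τ) → M(U', τ)`. [cite: KhareThorne2017, §6.3] [cite: Hida1994AIF, §2] -/
theorem shapiroIso_hom_comp_inducedMap_augMap :
    (shapiroIso ι τ hU hU' hle π hker s hs).hom ≫ inducedMap ι τ hU' π (piRegular R Q)
        (Representation.trivial R Q R) (augMap R Q) (augMap_equivariant R Q) =
      trRepHom ι Δ τ hU hU' ≫ (trivRepIso ι τ hU' π).hom := by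
  refine Rep.hom_ext (Representation.IntertwiningMap.ext (LinearMap.ext fun f => Subtype.ext
    (funext fun g => ?_)))
  change (augMap R Q).rTensor V ((tensorEquivPi R V Q).symm (toPiFun τ hU' s f g)) =
    (1 : R) ⊗ₜ ((trRepHom ι Δ τ hU hU').hom f : 𝒢 → V) g
  rw [rTensor_augMap_tensorEquivPi_symm, trRepHom_hom_apply_coe,
    heckeOp₂_one_apply_eq_sum_lift τ hU hU' hle π hker s hs f.2 g]

/-- **Diamonds ↔ 𝓕(right translations)**: the normalising Hecke operator `[U (s q₀) U]` of a lift
(the diamond operator of `q₀`) corresponds under Shapiro to `𝓕(R_{q₀})`, `(R_{q₀} φ)(q) = φ(q q₀)`.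
[cite: Hida1994AIF, §2] [cite: KhareThorne2017, §6.3] -/
theorem heckeRepHom_lift_comp_shapiroIso_hom (q₀ : Q) :
    heckeRepHom ι Δ τ U hU (hU' (s q₀).2) ≫ (shapiroIso ι τ hU hU' hle π hker s hs).hom =
      (shapiroIso ι τ hU hU' hle π hker s hs).hom ≫ inducedMap ι τ hU' π (piRegular R Q) (piRegular R Q)
        (rightShift R Q q₀) (rightShift_equivariant R Q q₀) := by
  refine Rep.hom_ext (Representation.IntertwiningMap.ext (LinearMap.ext fun f => Subtype.ext
    (funext fun g => ?_)))
  change (tensorEquivPi R V Q).symm (toPiFun τ hU' s ((heckeRepHom ι Δ τ U hU (hU' (s q₀).2)).hom f) g) =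
    (rightShift R Q q₀).rTensor V ((tensorEquivPi R V Q).symm (toPiFun τ hU' s f g))
  rw [LinearEquiv.symm_apply_eq, heckeRepHom_hom_apply_coe,
    heckeOp_apply_of_normalizing hU (hU' (s q₀).2) (lift_normalizing hle π hker s q₀) f.2]
  have hnat := LinearMap.congr_fun (tensorEquivPi_comp_rTensor_funLeft (R := R) (V := V) (Q := Q)
    fun q => q * q₀) ((tensorEquivPi R V Q).symm (toPiFun τ hU' s f g))
  simp only [LinearMap.comp_apply, LinearEquiv.coe_coe, LinearEquiv.apply_symm_apply] at hnat
  change _ = tensorEquivPi R V Q ((LinearMap.funLeft R R fun q => q * q₀).rTensor V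
    ((tensorEquivPi R V Q).symm (toPiFun τ hU' s f g)))
  rw [hnat]
  funext q
  rw [LinearMap.funLeft_apply]
  exact toPiFun_act_lift τ hU hU' π hker s hs f.2 q₀ g q

/-- **`[U α U] ↔ U_p^𝓕` at the small level**: for an adapted family `α_j` whose cosets `α_j U`
enumerate `UαU/U`, the Hecke operator `[UαU]` on `M(U, τ)` corresponds under Shapiro to the
operator `inducedHecke` on `𝓕(R[Q])`. [cite: KhareThorne2017, §6.3, Lemma 6.5] -/
theorem heckeRepHom_comp_shapiroIso_hom {α : 𝒢} (hα : α ∈ Δ) {J : Type} [Fintype J] {a : J → 𝒢}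
    (ha : IsAdaptedFamily Δ U' π a)
    (hbij : Set.BijOn (fun j => ((a j : 𝒢) : 𝒢 ⧸ U)) Set.univ (ArithmeticQuotient.doubleCosetQuot U α)) :
    heckeRepHom ι Δ τ U hU hα ≫ (shapiroIso ι τ hU hU' hle π hker s hs).hom =
      (shapiroIso ι τ hU hU' hle π hker s hs).hom ≫ inducedHecke ι τ hU' π (piRegular R Q) ha := by
  refine Rep.hom_ext (Representation.IntertwiningMap.ext (LinearMap.ext fun f => Subtype.ext
    (funext fun g => ?_)))
  change (tensorEquivPi R V Q).symm (toPiFun τ hU' s ((heckeRepHom ι Δ τ U hU hα).hom f) g) =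
    (((inducedHecke ι τ hU' π (piRegular R Q) ha).hom
      ((shapiroIso ι τ hU hU' hle π hker s hs).hom.hom f) :
        sections U'.toSubmonoid (inducedCoeff τ hU' π (piRegular R Q)) U') : 𝒢 → (Q → R) ⊗[R] V) g
  rw [inducedHecke_hom_apply_coe, LinearEquiv.symm_apply_eq, map_sum, heckeRepHom_hom_apply_coe]
  funext q
  rw [toPiFun_heckeOp τ hU hU' π hker s hs f.2 ha hbij g q, Finset.sum_apply]
  refine Finset.sum_congr rfl fun j _ => ?_
  have hnat := LinearMap.congr_fun (tensorEquivPi_comp_lTensor (R := R) (Q := Q) (τ ⟨a j, ha.mem j⟩))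
    ((tensorEquivPi R V Q).symm (toPiFun τ hU' s f (g * a j)))
  simp only [LinearMap.comp_apply, LinearEquiv.coe_coe, LinearEquiv.apply_symm_apply] at hnat
  change _ = tensorEquivPi R V Q ((τ ⟨a j, ha.mem j⟩).lTensor (Q → R)
    ((tensorEquivPi R V Q).symm (toPiFun τ hU' s f (g * a j)))) q
  rw [hnat, LinearMap.compLeft_apply, Function.comp_apply]

omit [Fintype Q] [DecidableEq Q] in
/-- **`[U' α U'] ↔ U_p^𝓕` at the big level**: for an adapted family `α_j` whose cosets `α_j U'`
enumerate `U'αU'/U'`, the Hecke operator `[U'αU']` on `M(U', τ)` corresponds under `trivRepIso`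
to `inducedHecke` on `𝓕(R)`. [cite: KhareThorne2017, §6.3, Lemma 6.5] -/
theorem heckeRepHom_comp_trivRepIso_hom {α : 𝒢} (hα : α ∈ Δ) {J : Type} [Fintype J] {a : J → 𝒢}
    (ha : IsAdaptedFamily Δ U' π a)
    (hbij : Set.BijOn (fun j => ((a j : 𝒢) : 𝒢 ⧸ U')) Set.univ (ArithmeticQuotient.doubleCosetQuot U' α)) :
    heckeRepHom ι Δ τ U' hU' hα ≫ (trivRepIso ι τ hU' π).hom =
      (trivRepIso ι τ hU' π).hom ≫ inducedHecke ι τ hU' π (Representation.trivial R Q R) ha := by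
  refine Rep.hom_ext (Representation.IntertwiningMap.ext (LinearMap.ext fun f => Subtype.ext
    (funext fun g => ?_)))
  change (1 : R) ⊗ₜ ((heckeRepHom ι Δ τ U' hU' hα).hom f : 𝒢 → V) g =
    (((inducedHecke ι τ hU' π (Representation.trivial R Q R) ha).hom
      ((trivRepIso ι τ hU' π).hom.hom f) :
        sections U'.toSubmonoid (inducedCoeff τ hU' π (Representation.trivial R Q R)) U') :
          𝒢 → R ⊗[R] V) g
  rw [inducedHecke_hom_apply_coe, heckeRepHom_hom_apply_coe,
    heckeOp_apply_eq_sum_of_bijOn hU' f.2 a ha.mem hbij, Finset.sum_apply, TensorProduct.tmul_sum]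
  refine Finset.sum_congr rfl fun j _ => ?_
  rw [act_of_mem (ha.mem j), fnAction_apply, trivRepIso_hom_apply_coe, LinearMap.lTensor_tmul]

end Shapiro

end LevelAction

end Literature.NumberTheory.Automorphic
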